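import Summits.QuantumFields.GaugeBoot.DLRPlaquetteSign
import HarnessLib

/-!
# The DLR plaquette sign rule for EVERY representation: `0 < β · Σ_{p ∋ e} (u_p - m₀(ρ))`
(gauge-boot, Class B; all-representations form 2/3)

HONEST FRAMING (cell `pub-gaugeboot`, page 1 of every file): the venture produces certified bounds
on lattice expectations at stated coupling, gauge group, dimension and torus size; NOT a mass gap,
NOT a continuum limit, NOT a string tension; NOT Yang–Mills-summit-bearing (barriers
`FixedCouplingUltralocality`, `PerturbativeInvisibility`). Structural statement for the Class-B
column (SCOPING A18); certifies no number.

## Content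

`HaarShiftPlaquetteSign.lean` proved the sign rule `0 < β · Σ_{p ∋ e} ∫ Re tr ρ(U_p) dμ` for one-link
Haar-shift (DLR) states under the hypothesis `hρ0 : ∀ m, ∫ Re tr ρ(g m) dg = 0` (no invariant
vectors). The hypothesis is removed here: for EVERY continuous `ρ : G → M_N(ℂ)` the two-sided Haar
averages of the character are the constant `m₀(ρ) = ∫ Re tr ρ(k) dk` (the multiplicity of the trivial
representation, `HaarAverageProjection.re_trace_haarAvg`), so

* `integral_re_trace_twoSided_eq` — `∫ Re tr ρ(a g b) dg = ∫ Re tr ρ(a g⁻¹ b) dg = m₀(ρ)`;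
* `integral_haar_plaquetteObs_update_eq` — the Haar average over one link of a plaquette character
  is `m₀(ρ)`; ★ `integral_haar_shiftAction_eq` — `∫ Δ_g(U) dg = Σ_{p ∋ e} (Re tr ρ(U_p) - m₀(ρ))`
  pointwise; `integral_haar_integral_shiftAction_eq` (Fubini);
* `eq_one_of_re_trace_eq_card` — `Re tr ρ(g) = N` forces `ρ(g) = 1` (unitary trick), so
  "`ρ` non-trivial" is `∃ g, Re tr ρ(g) ≠ N`;
* ★★★ **`IsHaarShiftState.mul_sum_integral_plaquetteObs_sub_pos`** — THE SIGN RULE FOR EVERY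
  NON-TRIVIAL `ρ` (`G` compact metrisable, `d ≥ 2`, `β ≠ 0`, `μ` any probability one-link Haar-shift
  state; no translation invariance, extremality or RP): for every link `e`,
  `0 < β · Σ_{p ∋ e} (∫ Re tr ρ(U_p) dμ - m₀(ρ))`; `…_lt_of_neg` / `…_lt_of_pos`
  (`β < 0`: `Σ_{p ∋ e} u_p < #{p ∋ e}·m₀(ρ)`; `β > 0`: `>`);
* ★★ `mul_sum_integral_plaquetteObs_sub_pos_of_mem_ymGibbsMeasures` (every DLR state `μ ∈ 𝒢(β)`),
  ★★ `mul_sum_integral_plaquetteObs_sub_pos_of_mem_infiniteVolumeLimitPoints` (every torus limit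
  point), `ClassBState.mul_sum_integral_plaquetteObs_sub_pos`.

Part 3 (`ClassBNegativeCouplingAllReps.lean`): with `CutLoopProjectedPositivity` (`u_p ≥ m₀` under
diagonal RP) Class B at `β < 0` is inhabited iff `ρ` is trivial.

Elementary; not in print in this form as far as the cell's searches go (DLR states: Georgii 2011 §2).
-/

open MeasureTheory Complex Finset Function
open scoped ComplexOrder Matrix

namespace Summit.QuantumFields.GaugeBoot

open Literature.MathematicalPhysics.QuantumFieldTheory (haarProbability integrable_haar_of_continuous
  integral_haar_conj_eq integral_haar_conj_inv_eq)
open Literature.MathematicalPhysics.QuantumLattice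
open Literature.RepresentationTheory.CompactGroups

noncomputable section

variable {d N : ℕ} {G : Type*} [Group G] [TopologicalSpace G] [IsTopologicalGroup G]
  [CompactSpace G] [MeasurableSpace G] [BorelSpace G] (ρ : G →* Matrix (Fin N) (Fin N) ℂ)

/-! ## A constant character forces the identity -/

section Trivial

omit [MeasurableSpace G] [BorelSpace G] in
/-- **`Re tr ρ(g) = N` forces `ρ(g) = 1`** for a continuous `N`-dimensional representation of a
compact group: the unitarised `σ(g)` has diagonal entries of modulus `≤ 1` with real parts summing to
`N`, hence equal to `1`, and unit rows, hence is the identity; `ρ(g) = B⁻¹ σ(g) B`. So `ρ` is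
non-trivial iff `∃ g, Re tr ρ(g) ≠ N`. -/
theorem eq_one_of_re_trace_eq_card (hρ : Continuous ρ) (g : G) (h : ((ρ g).trace).re = N) :
    ρ g = 1 := by
  set U := CompactGroup.unitarize ρ hρ g with hU
  have hUU : U * star U = 1 := CompactGroup.unitarize_mul_star_self ρ hρ g
  have hle1 : ∀ a b, ‖U a b‖ ≤ 1 := fun a b => CompactGroup.norm_unitarize_apply_le_one ρ hρ g a b
  have hsum : ∑ a, (U a a).re = N := by
    have htr : (U.trace).re = N := by rw [hU, CompactGroup.trace_unitarize ρ hρ g]; exact h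
    simpa only [Matrix.trace, Matrix.diag_apply, Complex.re_sum] using htr
  -- every diagonal real part is `1`
  have hre1 : ∀ a, (U a a).re = 1 := by
    have h0 : ∑ a, (1 - (U a a).re) = 0 := by
      rw [Finset.sum_sub_distrib, hsum]; simp
    have hz := (Finset.sum_eq_zero_iff_of_nonneg fun a _ =>
      sub_nonneg.2 ((Complex.re_le_norm _).trans (hle1 a a))).1 h0
    intro a
    have := hz a (Finset.mem_univ a)
    linarith
  -- hence every diagonal entry is `1`
  have hdiag : ∀ a, U a a = 1 := by
    intro a
    have hn : ‖U a a‖ = 1 :=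
      le_antisymm (hle1 a a) (by simpa only [hre1 a] using Complex.re_le_norm (U a a))
    have him : (U a a).im = 0 := by
      have hsq : ‖U a a‖ ^ 2 = (U a a).re ^ 2 + (U a a).im ^ 2 := by
        rw [Complex.sq_norm, Complex.normSq_apply]; ring
      rw [hn, hre1 a] at hsq
      nlinarith
    exact Complex.ext (by simp [hre1 a]) (by simp [him])
  -- unit rows kill the off-diagonal entries
  have hrow : ∀ a, ∑ b, ‖U a b‖ ^ 2 = 1 := by
    intro a
    have h1 := congrFun (congrFun hUU a) a
    simp only [Matrix.mul_apply, Matrix.star_apply, Complex.star_def, Complex.mul_conj,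
      Matrix.one_apply_eq] at h1
    have h2 : ((∑ b, ‖U a b‖ ^ 2 : ℝ) : ℂ) = 1 := by
      rw [← h1]; push_cast; exact Finset.sum_congr rfl fun b _ => by rw [Complex.normSq_eq_norm_sq]; norm_cast
    exact_mod_cast h2
  have hoff : ∀ a b, a ≠ b → U a b = 0 := by
    intro a b hab
    have h1 := hrow a
    rw [← Finset.add_sum_erase _ _ (Finset.mem_univ a), hdiag a, norm_one, one_pow] at h1
    have hz : ∑ x ∈ Finset.univ.erase a, ‖U a x‖ ^ 2 = 0 := by linarith
    have hb := (Finset.sum_eq_zero_iff_of_nonneg fun x _ => sq_nonneg _).1 hz b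
      (Finset.mem_erase.2 ⟨fun h => hab h.symm, Finset.mem_univ b⟩)
    exact norm_eq_zero.1 (pow_eq_zero_iff two_ne_zero |>.1 hb)
  have hU1 : U = 1 := by
    ext a b
    by_cases hab : a = b
    · subst hab; rw [hdiag a, Matrix.one_apply_eq]
    · rw [hoff a b hab, Matrix.one_apply_ne hab]
  -- back to `ρ`
  have hB := CompactGroup.isUnit_det_unitarizer ρ hρ
  have h2 : CompactGroup.unitarizer ρ hρ * ρ g * (CompactGroup.unitarizer ρ hρ)⁻¹ = 1 := by
    rw [← CompactGroup.unitarize_apply ρ hρ g]; exact hU1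
  calc ρ g = (CompactGroup.unitarizer ρ hρ)⁻¹ *
        (CompactGroup.unitarizer ρ hρ * ρ g * (CompactGroup.unitarizer ρ hρ)⁻¹) *
        CompactGroup.unitarizer ρ hρ := by
          rw [Matrix.mul_assoc, Matrix.mul_assoc, Matrix.nonsing_inv_mul _ hB, Matrix.mul_one,
            ← Matrix.mul_assoc, Matrix.nonsing_inv_mul _ hB, Matrix.one_mul]
    _ = 1 := by rw [h2, Matrix.mul_one, Matrix.nonsing_inv_mul _ hB]

omit [MeasurableSpace G] [BorelSpace G] in
/-- `ρ` is trivial iff its character is the constant `N`. -/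
theorem forall_eq_one_iff_re_trace (hρ : Continuous ρ) :
    (∀ g, ρ g = 1) ↔ ∀ g, ((ρ g).trace).re = N := by
  refine ⟨fun h g => ?_, fun h g => eq_one_of_re_trace_eq_card ρ hρ g (h g)⟩
  rw [h g, Matrix.trace_one, Fintype.card_fin]; simp

end Trivial

/-! ## Haar averages over one link: the constant `m₀(ρ)` -/

section Haar

/-- **Two-sided Haar averages of the character are the constant `m₀(ρ) = ∫ Re tr ρ dk`**:
`∫ Re tr ρ(a g b) dg = m₀(ρ)` and `∫ Re tr ρ(a g⁻¹ b) dg = m₀(ρ)` (two-sided and inversion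
invariance of Haar measure on a compact group; no hypothesis on `ρ`). -/
theorem integral_re_trace_twoSided_eq (a b : G) :
    ∫ g, ((ρ (a * g * b)).trace).re ∂(haarProbability G) =
        ∫ g, ((ρ g).trace).re ∂(haarProbability G) ∧
      ∫ g, ((ρ (a * g⁻¹ * b)).trace).re ∂(haarProbability G) =
        ∫ g, ((ρ g).trace).re ∂(haarProbability G) :=
  ⟨integral_haar_conj_eq (fun g => ((ρ g).trace).re) a b,
    integral_haar_conj_inv_eq (fun g => ((ρ g).trace).re) a b⟩

/-- **The Haar average over one link of a plaquette character is `m₀(ρ)`**: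
`∫ Re tr ρ(U_p[e ↦ g⁻¹ U_e]) dg = ∫ Re tr ρ dk` for `e` a link of `p`. -/
theorem integral_haar_plaquetteObs_update_eq (p : ZdPlaquette d) {e : ZdEdge d}
    (he : e ∈ plaquetteEdges p) (U : LGConfig d G) :
    ∫ g, plaquetteObs ρ p.1 p.2.1.1 p.2.1.2 (Function.update U e (g⁻¹ * U e)) ∂(haarProbability G)
      = ∫ g, ((ρ g).trace).re ∂(haarProbability G) := by
  obtain ⟨a, b, h | h⟩ := plaquetteHolonomyZd_update_affine p he U
  · simp only [plaquetteObs, h]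
    have : ∀ g : G, a * (g⁻¹ * U e) * b = a * g⁻¹ * (U e * b) := fun g => by group
    simp_rw [this]
    exact (integral_re_trace_twoSided_eq ρ a (U e * b)).2
  · simp only [plaquetteObs, h]
    have : ∀ g : G, a * (g⁻¹ * U e)⁻¹ * b = a * (U e)⁻¹ * g * b := fun g => by group
    simp_rw [this]
    exact (integral_re_trace_twoSided_eq ρ (a * (U e)⁻¹) b).1

/-- ★ **The Haar average over `g` of the one-link shift of the boundary action**:
`∫ Δ_g(U) dg = Σ_{p ∋ e} (Re tr ρ(U_p) - m₀(ρ))`, pointwise in `U`, for EVERY continuous `ρ`. -/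
theorem integral_haar_shiftAction_eq (hρ : Continuous ρ) (e : ZdEdge d) (U : LGConfig d G) :
    ∫ g, (wilsonBoundaryAction ρ {e} (Function.update U e (g⁻¹ * U e)) - wilsonBoundaryAction ρ {e} U)
        ∂(haarProbability G) =
      ∑ p ∈ plaquettesTouching ({e} : Finset (ZdEdge d)),
        (plaquetteObs ρ p.1 p.2.1.1 p.2.1.2 U - ∫ g, ((ρ g).trace).re ∂(haarProbability G)) := by
  simp only [wilsonBoundaryAction]
  have hcont : ∀ p : ZdPlaquette d, Continuous fun g : G =>
      plaquetteObs ρ p.1 p.2.1.1 p.2.1.2 (Function.update U e (g⁻¹ * U e)) := fun p =>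
    (continuous_plaquetteObs ρ hρ _ _ _).comp
      ((integral_haar_shiftAction.continuous_glueMul_aux e U).comp continuous_inv)
  have hint : ∀ p : ZdPlaquette d, Integrable (fun g : G =>
      (N : ℝ) - plaquetteObs ρ p.1 p.2.1.1 p.2.1.2 (Function.update U e (g⁻¹ * U e)))
      (haarProbability G) := fun p =>
    (integrable_const _).sub (integrable_haar_of_continuous (hcont p))
  rw [integral_sub (integrable_finsetSum _ fun p _ => hint p) (integrable_const _),
    integral_finsetSum _ fun p _ => hint p, integral_const, probReal_univ, one_smul]
  rw [← Finset.sum_sub_distrib]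
  have hterm : ∀ p ∈ plaquettesTouching ({e} : Finset (ZdEdge d)),
      ∫ g, ((N : ℝ) - plaquetteObs ρ p.1 p.2.1.1 p.2.1.2 (Function.update U e (g⁻¹ * U e)))
        ∂(haarProbability G) = N - ∫ g, ((ρ g).trace).re ∂(haarProbability G) := by
    intro p hp
    have he : e ∈ plaquetteEdges p := by
      obtain ⟨e', he'⟩ := mem_plaquettesTouching_iff.1 hp
      rw [Finset.mem_inter, Finset.mem_singleton] at he'
      exact he'.2 ▸ he'.1
    rw [integral_sub (integrable_const _) (integrable_haar_of_continuous (hcont p)),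
      integral_const, probReal_univ, one_smul, integral_haar_plaquetteObs_update_eq ρ p he U]
  exact Finset.sum_congr rfl fun p hp => by rw [hterm p hp]; ring

end Haar

/-! ## Averaging over the state (Fubini) -/

section Fubini

variable [SecondCountableTopology G]

/-- ★ **Averaging the one-link shift over the group**, every continuous `ρ`, every finite measure
`μ` on configurations: `∫ (∫ Δ_g dμ) dg = Σ_{p ∋ e} ∫ (Re tr ρ(U_p) - m₀(ρ)) dμ`. -/
theorem integral_haar_integral_shiftAction_eq (hρ : Continuous ρ)
    (μ : Measure (LGConfig d G)) [IsFiniteMeasure μ] (e : ZdEdge d) :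
    ∫ g, (∫ U, (wilsonBoundaryAction ρ {e} (Function.update U e (g⁻¹ * U e)) -
      wilsonBoundaryAction ρ {e} U) ∂μ) ∂(haarProbability G) =
      ∑ p ∈ plaquettesTouching ({e} : Finset (ZdEdge d)),
        ∫ U, (plaquetteObs ρ p.1 p.2.1.1 p.2.1.2 U - ∫ g, ((ρ g).trace).re ∂(haarProbability G)) ∂μ := by
  have hc := continuous_shiftAction_uncurry ρ hρ e
  obtain ⟨C, hC⟩ := isCompact_univ.exists_bound_of_continuousOn hc.continuousOn
  have hint : Integrable (uncurry fun (g : G) (U : LGConfig d G) =>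
      wilsonBoundaryAction ρ {e} (Function.update U e (g⁻¹ * U e)) - wilsonBoundaryAction ρ {e} U)
      ((haarProbability G).prod μ) :=
    Integrable.of_bound hc.aestronglyMeasurable C (ae_of_all _ fun q => hC q (Set.mem_univ _))
  rw [integral_integral_swap hint]
  have hI : ∀ p : ZdPlaquette d, Integrable (fun U : LGConfig d G =>
      plaquetteObs ρ p.1 p.2.1.1 p.2.1.2 U - ∫ g, ((ρ g).trace).re ∂(haarProbability G)) μ := fun p =>
    (integrable_of_continuous_real (continuous_plaquetteObs ρ hρ _ _ _) μ).sub (integrable_const _)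
  rw [← integral_finsetSum _ fun p _ => hI p]
  exact integral_congr_ae (ae_of_all _ fun U => integral_haar_shiftAction_eq ρ hρ e U)

end Fubini

/-! ## The sign rule for every representation -/

section SignRule

variable [SecondCountableTopology G]

/-- ★★★ **THE DLR SIGN RULE FOR EVERY NON-TRIVIAL REPRESENTATION.** `G` compact metrisable; `ρ`
continuous and non-trivial (`∃ g, Re tr ρ(g) ≠ N`, cf. `eq_one_of_re_trace_eq_card`); `d ≥ 2`; `μ` a
probability measure on `LGConfig d G` with the one-link Haar-shift (DLR) identity at coupling `β ≠ 0`.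
Then for every link `e`: `0 < β · Σ_{p ∋ e} (∫ Re tr ρ(U_p) dμ - m₀(ρ))`, `m₀(ρ) = ∫ Re tr ρ dk` the
multiplicity of the trivial representation in `ρ`. (Jensen on the Haar-shift identity with the
trivial observable; Haar average; strictness from `HaarShiftSupport`: `∫ Δ_g = 0` for all `g` would
force `Re tr ρ ≡ N`.) No translation invariance, extremality or reflection positivity is assumed;
`HaarShiftPlaquetteSign.lean` is the case `m₀ = 0`. -/
theorem IsHaarShiftState.mul_sum_integral_plaquetteObs_sub_pos (hρ : Continuous ρ)
    (hρ1 : ∃ g, ((ρ g).trace).re ≠ N) (hd : 2 ≤ d) {β : ℝ} (hβ : β ≠ 0)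
    {μ : Measure (LGConfig d G)} [IsProbabilityMeasure μ] (hμ : IsHaarShiftState ρ β μ)
    (e : ZdEdge d) :
    0 < β * ∑ p ∈ plaquettesTouching ({e} : Finset (ZdEdge d)),
      (∫ U, plaquetteObs ρ p.1 p.2.1.1 p.2.1.2 U ∂μ - ∫ g, ((ρ g).trace).re ∂(haarProbability G)) := by
  haveI : (haarProbability G).IsOpenPosMeasure := by unfold haarProbability; infer_instance
  set φ : G → ℝ := fun g => β * ∫ U, (wilsonBoundaryAction ρ {e} (Function.update U e (g⁻¹ * U e)) -
      wilsonBoundaryAction ρ {e} U) ∂μ with hφ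
  have hφ0 : ∀ g, 0 ≤ φ g := fun g => hμ.mul_integral_shiftAction_nonneg ρ hρ e g
  have hφc : Continuous φ := continuous_const.mul (continuous_integral_shiftAction ρ hρ μ e)
  have hφint : ∫ g, φ g ∂(haarProbability G) = β * ∑ p ∈ plaquettesTouching ({e} : Finset (ZdEdge d)),
      (∫ U, plaquetteObs ρ p.1 p.2.1.1 p.2.1.2 U ∂μ - ∫ g, ((ρ g).trace).re ∂(haarProbability G)) := by
    simp only [hφ]
    rw [integral_const_mul, integral_haar_integral_shiftAction_eq ρ hρ μ e]
    congr 1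
    refine Finset.sum_congr rfl fun p _ => ?_
    rw [integral_sub (integrable_of_continuous_real (continuous_plaquetteObs ρ hρ _ _ _) μ)
      (integrable_const _), integral_const, probReal_univ, one_smul]
  rw [← hφint]
  have hnn : 0 ≤ ∫ g, φ g ∂(haarProbability G) := integral_nonneg fun g => hφ0 g
  rcases hnn.lt_or_eq with hlt | heq
  · exact hlt
  · exfalso
    -- `φ ≡ 0`, hence `∫ Δ_g dμ = 0` and `Δ_g ≡ 0` for every `g`
    have hae : φ =ᵐ[haarProbability G] 0 :=
      (integral_eq_zero_iff_of_nonneg hφ0 (integrable_haar_of_continuous hφc)).1 heq.symm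
    have hφz : φ = 0 := (Continuous.ae_eq_iff_eq (haarProbability G) hφc continuous_const).1 hae
    have hΔ0 : ∀ g U, wilsonBoundaryAction ρ {e} (Function.update U e (g⁻¹ * U e)) -
        wilsonBoundaryAction ρ {e} U = 0 := fun g => by
      refine hμ.shiftAction_eq_zero_of_integral_eq_zero ρ hρ hβ e g ?_
      have h := congrFun hφz g
      simp only [hφ, Pi.zero_apply, mul_eq_zero] at h
      exact h.resolve_left hβ
    -- at the trivial configuration: `Re tr ρ(g) = N` for every `g`, contradicting `hρ1`
    have hcard : (0 : ℝ) < (plaquettesTouching ({e} : Finset (ZdEdge d))).card := by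
      exact_mod_cast Finset.card_pos.2 (plaquettesTouching_singleton_nonempty hd e)
    have htr : ∀ g : G, ((ρ g).trace).re = N := fun g => by
      have h := hΔ0 g 1
      rw [shiftAction_one ρ hρ e g] at h
      rcases mul_eq_zero.1 h with h' | h'
      · exact absurd h' hcard.ne'
      · linarith
    obtain ⟨g, hg⟩ := hρ1
    exact hg (htr g)

/-- ★★★ `β < 0`: in every DLR state and for every link `e`,
`Σ_{p ∋ e} ∫ Re tr ρ(U_p) dμ < #{p ∋ e} · m₀(ρ)` (`ρ` non-trivial, `d ≥ 2`). -/
theorem IsHaarShiftState.sum_integral_plaquetteObs_lt_of_neg (hρ : Continuous ρ)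
    (hρ1 : ∃ g, ((ρ g).trace).re ≠ N) (hd : 2 ≤ d) {β : ℝ} (hβ : β < 0)
    {μ : Measure (LGConfig d G)} [IsProbabilityMeasure μ] (hμ : IsHaarShiftState ρ β μ)
    (e : ZdEdge d) :
    ∑ p ∈ plaquettesTouching ({e} : Finset (ZdEdge d)), ∫ U, plaquetteObs ρ p.1 p.2.1.1 p.2.1.2 U ∂μ <
      (plaquettesTouching ({e} : Finset (ZdEdge d))).card *
        ∫ g, ((ρ g).trace).re ∂(haarProbability G) := by
  have h := hμ.mul_sum_integral_plaquetteObs_sub_pos ρ hρ hρ1 hd hβ.ne e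
  rw [Finset.sum_sub_distrib, Finset.sum_const, nsmul_eq_mul] at h
  have hneg : ∑ p ∈ plaquettesTouching ({e} : Finset (ZdEdge d)),
      ∫ U, plaquetteObs ρ p.1 p.2.1.1 p.2.1.2 U ∂μ -
      (plaquettesTouching ({e} : Finset (ZdEdge d))).card *
        ∫ g, ((ρ g).trace).re ∂(haarProbability G) < 0 := by
    by_contra hge
    push Not at hge
    nlinarith
  linarith

/-- ★★★ `β > 0`: in every DLR state and for every link `e`,
`#{p ∋ e} · m₀(ρ) < Σ_{p ∋ e} ∫ Re tr ρ(U_p) dμ` (`ρ` non-trivial, `d ≥ 2`). -/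
theorem IsHaarShiftState.sum_integral_plaquetteObs_gt_of_pos (hρ : Continuous ρ)
    (hρ1 : ∃ g, ((ρ g).trace).re ≠ N) (hd : 2 ≤ d) {β : ℝ} (hβ : 0 < β)
    {μ : Measure (LGConfig d G)} [IsProbabilityMeasure μ] (hμ : IsHaarShiftState ρ β μ)
    (e : ZdEdge d) :
    (plaquettesTouching ({e} : Finset (ZdEdge d))).card *
        ∫ g, ((ρ g).trace).re ∂(haarProbability G) <
      ∑ p ∈ plaquettesTouching ({e} : Finset (ZdEdge d)),
        ∫ U, plaquetteObs ρ p.1 p.2.1.1 p.2.1.2 U ∂μ := by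
  have h := hμ.mul_sum_integral_plaquetteObs_sub_pos ρ hρ hρ1 hd hβ.ne' e
  rw [Finset.sum_sub_distrib, Finset.sum_const, nsmul_eq_mul] at h
  have hpos := pos_of_mul_pos_right h hβ.le
  linarith

end SignRule

/-! ## DLR states, infinite-volume limit points, Class-B states -/

section Consequences

variable [SecondCountableTopology G]

/-- ★★ **The sign rule for every infinite-volume DLR state `μ ∈ 𝒢(β)`** (`ρ` continuous and
non-trivial, `d ≥ 2`, `β ≠ 0`): `0 < β · Σ_{p ∋ e} (∫ Re tr ρ(U_p) dμ - m₀(ρ))` for every link `e`. -/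
theorem mul_sum_integral_plaquetteObs_sub_pos_of_mem_ymGibbsMeasures [T2Space G] (hρ : Continuous ρ)
    (hρ1 : ∃ g, ((ρ g).trace).re ≠ N) (hd : 2 ≤ d) {β : ℝ} (hβ : β ≠ 0)
    {μ : Measure (LGConfig d G)} (hμ : μ ∈ ymGibbsMeasures ρ β) (e : ZdEdge d) :
    0 < β * ∑ p ∈ plaquettesTouching ({e} : Finset (ZdEdge d)),
      (∫ U, plaquetteObs ρ p.1 p.2.1.1 p.2.1.2 U ∂μ - ∫ g, ((ρ g).trace).re ∂(haarProbability G)) := by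
  have hG : Literature.Probability.LatticeModels.IsGibbsMeasure (ymSpecification ρ β) μ := hμ
  haveI := hG.isProbabilityMeasure
  exact (isHaarShiftState_of_mem_ymGibbsMeasures ρ hρ hμ).mul_sum_integral_plaquetteObs_sub_pos
    ρ hρ hρ1 hd hβ e

/-- ★★ **The sign rule for every infinite-volume limit point of the torus Wilson states** (`β ≠ 0`,
`ρ` continuous and non-trivial, `d ≥ 2`). -/
theorem mul_sum_integral_plaquetteObs_sub_pos_of_mem_infiniteVolumeLimitPoints [NeZero d] [T2Space G]
    (hρ : Continuous ρ) (hρ1 : ∃ g, ((ρ g).trace).re ≠ N) (hd : 2 ≤ d) {β : ℝ} (hβ : β ≠ 0)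
    {μ : Measure (LGConfig d G)} (hμ : μ ∈ infiniteVolumeLimitPoints (d := d) ρ β) (e : ZdEdge d) :
    0 < β * ∑ p ∈ plaquettesTouching ({e} : Finset (ZdEdge d)),
      (∫ U, plaquetteObs ρ p.1 p.2.1.1 p.2.1.2 U ∂μ - ∫ g, ((ρ g).trace).re ∂(haarProbability G)) := by
  obtain ⟨hprob, -, -, -, hhaar⟩ := classBInvariances_of_mem_infiniteVolumeLimitPoints ρ hρ hμ
  exact hhaar.mul_sum_integral_plaquetteObs_sub_pos ρ hρ hρ1 hd hβ e

/-- ★★ **The sign rule for every Class-B state** (`β ≠ 0`, `ρ` continuous and non-trivial,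
`d ≥ 2`): `0 < β · Σ_{p ∋ e} (u_p - m₀(ρ))`. -/
theorem ClassBState.mul_sum_integral_plaquetteObs_sub_pos (hρ : Continuous ρ)
    (hρ1 : ∃ g, ((ρ g).trace).re ≠ N) (hd : 2 ≤ d) {β : ℝ} (hβ : β ≠ 0) (ω : ClassBState d ρ β)
    (e : ZdEdge d) :
    0 < β * ∑ p ∈ plaquettesTouching ({e} : Finset (ZdEdge d)),
      (∫ U, plaquetteObs ρ p.1 p.2.1.1 p.2.1.2 U ∂ω.μ - ∫ g, ((ρ g).trace).re ∂(haarProbability G)) := by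
  haveI := ω.isProbabilityMeasure
  exact ω.haarShift.mul_sum_integral_plaquetteObs_sub_pos ρ hρ hρ1 hd hβ e

end Consequences

end

end Summit.QuantumFields.GaugeBoot
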